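import Mathlib
import Summits.MatrixMultiplication.MatrixMultiplication.Theses.AlgebraicSTPPDichotomy
import Literature.Computability.AlgebraicComplexity.GroupTheoreticMatMul
import Literature.Barriers.MatrixMultiplication.TricoloredSumFreeBarrier
import Literature.ModelTheory.PseudofiniteFields.DefinableSetsFiniteFields

/-!
# Sketch — crux-ideate round 1, ideator 2 (gen 2), crux `AlgebraicFrameBarrier` (stmt-MatrixMultiplication-7621)

First-lemma signatures of the three idea cards (deliberate `sorry`s; they must ELABORATE, not be proved):

* card `fourier-hyperplane-packing`      — `subspace_packing`, `frame_card_bound` (C⁺ = FrameBarrier with saving q^{1/2})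
* card `double-packing-langweil-integrality` — `half_density`, named fact `LangWeilConstructible`, `exact_stratum_absurd`
* card `galois-multiplicity-osculation`  — `threeD_le_two` (all families), `card_bounded_of_lt_four_mul` (algebraic, m < 4d)
-/

namespace Summit.MatrixMultiplication.MatrixMultiplication.Cruxes.AlgebraicFrameBarrier.Sketch

open scoped BigOperators Classical
open Finset Literature.Computability.AlgebraicComplexity

/-! ## Card 1 — fourier-hyperplane-packing -/

/-- **Subspace packing** (general-`d` form of the tree's `LineSTPP.hyperplane_packing`): in an STPP frame
family the blocks whose `A–B` flat `V i ⊔ W i` lies inside a fixed subspace `K` have disjoint difference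
sets `(V i ∖ 0) − (W i ∖ 0) ⊆ K`, so `∑_{V i ⊔ W i ≤ K} |A i||B i| ≤ |K|`. Provable now
(injectivity of `(i,a,b) ↦ a − b`, as in `IsSTPP.packing`). -/
theorem subspace_packing {F : Type*} [Field F] [Fintype F] {m N : ℕ}
    (V W U : Fin N → Submodule F (Fin m → F)) (A B C : Fin N → Finset (Fin m → F))
    (hA : ∀ i v, v ∈ A i ↔ v ∈ V i ∧ v ≠ 0) (hB : ∀ i v, v ∈ B i ↔ v ∈ W i ∧ v ≠ 0)
    (hC : ∀ i v, v ∈ C i ↔ v ∈ U i ∧ v ≠ 0) (hS : IsSTPP A B C) (hCne : ∀ i, (C i).Nonempty)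
    (K : Submodule F (Fin m → F)) :
    ∑ i ∈ univ.filter (fun i => V i ≤ K ∧ W i ≤ K), (A i).card * (B i).card ≤ Nat.card K := by
  classical
  set S : Finset (Fin N) := univ.filter (fun i => V i ≤ K ∧ W i ≤ K) with hSdef
  have hSmem : ∀ i, i ∈ S ↔ V i ≤ K ∧ W i ≤ K := fun i => by simp [hSdef]
  -- parametrise the pairs `(i, a, b)`, `a ∈ A i`, `b ∈ B i`, `i ∈ S`
  set T : Finset (Σ _ : Fin N, (Fin m → F) × (Fin m → F)) := S.sigma fun i => A i ×ˢ B i with hTdef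
  have hT : T.card = ∑ i ∈ S, (A i).card * (B i).card := by
    rw [hTdef, Finset.card_sigma]
    exact Finset.sum_congr rfl fun i _ => Finset.card_product _ _
  let φ : (Σ _ : Fin N, (Fin m → F) × (Fin m → F)) → (Fin m → F) := fun p => p.2.1 - p.2.2
  have hmem : ∀ p : (Σ _ : Fin N, (Fin m → F) × (Fin m → F)), p ∈ T ↔
      (V p.1 ≤ K ∧ W p.1 ≤ K) ∧ p.2.1 ∈ A p.1 ∧ p.2.2 ∈ B p.1 := by
    rintro ⟨i, a, b⟩
    simp [hTdef, Finset.mem_sigma, Finset.mem_product, hSmem]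
  have hmaps : Set.MapsTo φ (T : Set _) ((univ.filter fun x : Fin m → F => x ∈ K : Finset _) : Set _) := by
    rintro ⟨i, a, b⟩ hp
    obtain ⟨⟨hV, hW⟩, ha, hb⟩ := (hmem _).1 hp
    have haK : a ∈ K := hV ((hA i a).1 ha).1
    have hbK : b ∈ K := hW ((hB i b).1 hb).1
    simp only [Finset.coe_filter, Finset.mem_univ, true_and, Set.mem_setOf_eq, φ]
    exact K.sub_mem haK hbK
  have hinj : Set.InjOn φ (T : Set _) := by
    rintro ⟨i, a, b⟩ hp ⟨i', a', b'⟩ hp' heq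
    obtain ⟨-, ha, hb⟩ := (hmem _).1 hp
    obtain ⟨-, ha', hb'⟩ := (hmem _).1 hp'
    obtain ⟨c, hc⟩ := hCne i'
    have he : (a - a') + (b' - b) + (c - c) = 0 := by
      have h1 : a - b = a' - b' := heq
      have h2 : (a - a') + (b' - b) + (c - c) = (a - b) - (a' - b') := by abel
      rw [h2, h1, sub_self]
    obtain ⟨rfl, -, rfl, rfl, -⟩ := hS i i' i' a' ha' a ha b hb b' hb' c hc c hc he
    rfl
  calc ∑ i ∈ S, (A i).card * (B i).card = T.card := hT.symm
    _ ≤ (univ.filter fun x : Fin m → F => x ∈ K).card := Finset.card_le_card_of_injOn φ hmaps hinj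
    _ = Nat.card K := by
        rw [Nat.card_eq_fintype_card, ← Fintype.card_subtype]

/-- **C⁺ of card 1 = FrameBarrier with a half-power saving.** For balanced STPP frame families
(`dim V i = dim W i = dim U i = d ≥ 1`) in `F^m`: `N ≤ Cst · q^{m − 2d − 1/2}`.  Chain: block Fourier
transforms are annihilator-supported, `Ŝ(ξ) = q^{2d}·#{i : V i ⊔ W i ≤ ξ^⊥} − O(q^d N)`, so
`subspace_packing` gives `|Ŝ(ξ)| ≤ C q^{m−1}` for `ξ ≠ 0`; the zero-sum count
`Z = ∑ |A i||B i||C i| ≤ N q^{3d}` equals `|S||T||U|/q^m + error`, error `≤ C q^{m−1}(|T||U|)^{1/2}`. -/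
theorem frame_card_bound (m d : ℕ) (hd : 1 ≤ d) : ∃ Cst : ℝ, ∀ (F : Type) [Field F] [Fintype F]
    (N : ℕ) (V W U : Fin N → Submodule F (Fin m → F)) (A B C : Fin N → Finset (Fin m → F)),
    (∀ i v, v ∈ A i ↔ v ∈ V i ∧ v ≠ 0) → (∀ i v, v ∈ B i ↔ v ∈ W i ∧ v ≠ 0) →
    (∀ i v, v ∈ C i ↔ v ∈ U i ∧ v ≠ 0) →
    (∀ i, Module.finrank F (V i) = d ∧ Module.finrank F (W i) = d ∧ Module.finrank F (U i) = d) →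
    IsSTPP A B C →
    (N : ℝ) ≤ Cst * (Fintype.card F : ℝ) ^ ((m : ℝ) - 2 * d - 1 / 2) := by
  sorry

/-- Card 1 reaches the crux through the stronger route item: `FrameBarrier → AlgebraicFrameBarrier`
(proved in the disprover's `Disproof.lean`, §1, `algebraicFrameBarrier_of_frameBarrier`; restated). -/
theorem crux_of_frameBarrier :
    Theses.AlgebraicSTPPDichotomy.FrameBarrier → Theses.AlgebraicSTPPDichotomy.AlgebraicFrameBarrier := by
  intro hFB D e m dA dB dC r
  obtain ⟨ε, hε, q₀, hq⟩ := hFB m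
  refine ⟨ε, hε, q₀, ?_⟩
  intro F _ _ hF f g MA MB MC _ _ _ _ _ I A B C hI hA hB hC hS
  classical
  -- enumerate the index set
  let ι : Fin I.card → (Fin e → F) := fun i => ((I.equivFin.symm i : I) : Fin e → F)
  have hιmem : ∀ i, ι i ∈ I := fun i => (I.equivFin.symm i).2
  have hιinj : Function.Injective ι := fun i j h => I.equivFin.symm.injective (Subtype.ext h)
  -- the frames of the enumerated family
  let V : Fin I.card → Submodule F (Fin m → F) := fun i =>
    LinearMap.range (Matrix.mulVecLin (MA.map (MvPolynomial.eval (ι i))))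
  let W : Fin I.card → Submodule F (Fin m → F) := fun i =>
    LinearMap.range (Matrix.mulVecLin (MB.map (MvPolynomial.eval (ι i))))
  let U : Fin I.card → Submodule F (Fin m → F) := fun i =>
    LinearMap.range (Matrix.mulVecLin (MC.map (MvPolynomial.eval (ι i))))
  have key := hq F hF I.card V W U (fun i => A (ι i)) (fun i => B (ι i)) (fun i => C (ι i))
    (fun i v => hA (ι i) v) (fun i v => hB (ι i) v) (fun i v => hC (ι i) v) (hS I.card ι hιinj hιmem)
  have hsum : ∑ x ∈ I, (((A x).card * (B x).card * (C x).card : ℕ) : ℝ) ^ ((2 + ε) / 3)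
      = ∑ i : Fin I.card, (((A (ι i)).card * (B (ι i)).card * (C (ι i)).card : ℕ) : ℝ) ^ ((2 + ε) / 3) := by
    rw [← Finset.sum_coe_sort I]
    exact (Fintype.sum_equiv I.equivFin.symm
      (fun i => (((A (ι i)).card * (B (ι i)).card * (C (ι i)).card : ℕ) : ℝ) ^ ((2 + ε) / 3))
      (fun x : I => (((A x).card * (B x).card * (C x).card : ℕ) : ℝ) ^ ((2 + ε) / 3)) (fun i => rfl)).symm
  rw [hsum]
  exact key

/-! ## Card 2 — double-packing-langweil-integrality -/

/-- **Half-density lemma** (any finite abelian group, any STPP family with non-empty sets): with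
`S = ⊔ (A i − B i)`, `T = ⊔ (B i − C i)`, `U = ⊔ (C i − A i)` (genuine subsets of `H` by STPP) the number of
zero sums `s + t + u = 0` is EXACTLY `∑ |A i||B i||C i|` and is `≥ |S|(|T| + |U| − |H|)`. Provable now. -/
theorem half_density {H : Type*} [AddCommGroup H] [Fintype H] {N : ℕ} (A B C : Fin N → Finset H)
    (hS : IsSTPP A B C) (hne : ∀ i, (A i).Nonempty ∧ (B i).Nonempty ∧ (C i).Nonempty) :
    ((∑ i, (A i).card * (B i).card : ℕ) : ℤ) *
        (((∑ i, (B i).card * (C i).card : ℕ) : ℤ) + ((∑ i, (C i).card * (A i).card : ℕ) : ℤ)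
          - (Fintype.card H : ℤ))
      ≤ ((∑ i, (A i).card * (B i).card * (C i).card : ℕ) : ℤ) := by
  classical
  -- parametrising finsets of the three colour cones
  set SS : Finset (Σ _ : Fin N, H × H) := univ.sigma fun i => A i ×ˢ B i with hSSdef
  set TT : Finset (Σ _ : Fin N, H × H) := univ.sigma fun j => B j ×ˢ C j with hTTdef
  set UU : Finset (Σ _ : Fin N, H × H) := univ.sigma fun k => C k ×ˢ A k with hUUdef
  have memSS : ∀ p : (Σ _ : Fin N, H × H), p ∈ SS ↔ p.2.1 ∈ A p.1 ∧ p.2.2 ∈ B p.1 := by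
    rintro ⟨i, a, b⟩; simp [hSSdef]
  have memTT : ∀ p : (Σ _ : Fin N, H × H), p ∈ TT ↔ p.2.1 ∈ B p.1 ∧ p.2.2 ∈ C p.1 := by
    rintro ⟨i, a, b⟩; simp [hTTdef]
  have memUU : ∀ p : (Σ _ : Fin N, H × H), p ∈ UU ↔ p.2.1 ∈ C p.1 ∧ p.2.2 ∈ A p.1 := by
    rintro ⟨i, a, b⟩; simp [hUUdef]
  have hSScard : SS.card = ∑ i, (A i).card * (B i).card := by
    rw [hSSdef, Finset.card_sigma]; exact Finset.sum_congr rfl fun i _ => Finset.card_product _ _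
  have hTTcard : TT.card = ∑ i, (B i).card * (C i).card := by
    rw [hTTdef, Finset.card_sigma]; exact Finset.sum_congr rfl fun i _ => Finset.card_product _ _
  have hUUcard : UU.card = ∑ i, (C i).card * (A i).card := by
    rw [hUUdef, Finset.card_sigma]; exact Finset.sum_congr rfl fun i _ => Finset.card_product _ _
  let f : (Σ _ : Fin N, H × H) → H := fun p => p.2.1 - p.2.2
  -- `f` is injective on `UU` and on `TT` (STPP with a dummy element of the third colour)
  have hinjU : Set.InjOn f (UU : Set _) := by
    rintro ⟨k, c, a⟩ hp ⟨k', c', a'⟩ hp' heq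
    obtain ⟨hc, ha⟩ := (memUU _).1 hp
    obtain ⟨hc', ha'⟩ := (memUU _).1 hp'
    obtain ⟨b₀, hb₀⟩ := (hne k').2.1
    have h1 : c - a = c' - a' := heq
    have he : (a' - a) + (b₀ - b₀) + (c - c') = 0 := by
      have : (a' - a) + (b₀ - b₀) + (c - c') = (c - a) - (c' - a') := by abel
      rw [this, h1, sub_self]
    obtain ⟨-, hkk, rfl, -, rfl⟩ := hS k' k' k a ha a' ha' b₀ hb₀ b₀ hb₀ c' hc' c hc he
    subst hkk
    rfl
  have hinjT : Set.InjOn f (TT : Set _) := by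
    rintro ⟨j, b, c⟩ hp ⟨j', b', c'⟩ hp' heq
    obtain ⟨hb, hc⟩ := (memTT _).1 hp
    obtain ⟨hb', hc'⟩ := (memTT _).1 hp'
    obtain ⟨a₀, ha₀⟩ := (hne j).1
    have h1 : b - c = b' - c' := heq
    have he : (a₀ - a₀) + (b' - b) + (c - c') = 0 := by
      have : (a₀ - a₀) + (b' - b) + (c - c') = -((b - c) - (b' - c')) := by abel
      rw [this, h1, sub_self, neg_zero]
    obtain ⟨rfl, -, -, rfl, rfl⟩ := hS j j' j a₀ ha₀ a₀ ha₀ b hb b' hb' c' hc' c hc he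
    rfl
  set U : Finset H := UU.image f with hUdef
  have hUcard : U.card = UU.card := Finset.card_image_of_injOn hinjU
  -- the key consequence of STPP for a pair `(p, q)` whose sum is completed by an element of `U`
  have key : ∀ p ∈ SS, ∀ q ∈ TT, -(f p + f q) ∈ U → p.1 = q.1 ∧ p.2.2 = q.2.1 ∧ q.2.2 ∈ C p.1 := by
    rintro ⟨i, a, b⟩ hp ⟨j, b', c⟩ hq hU
    obtain ⟨ha, hb⟩ := (memSS _).1 hp
    obtain ⟨hb', hc⟩ := (memTT _).1 hq
    obtain ⟨⟨k, c', a'⟩, hr, hfr⟩ := Finset.mem_image.1 hU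
    obtain ⟨hc', ha'⟩ := (memUU _).1 hr
    have hfr' : c' - a' = -((a - b) + (b' - c)) := hfr
    have he : (a - a') + (b' - b) + (c' - c) = 0 := by
      have : (a - a') + (b' - b) + (c' - c) = (a - b) + (b' - c) + (c' - a') := by abel
      rw [this, hfr']; abel
    obtain ⟨rfl, rfl, -, rfl, rfl⟩ := hS i j k a' ha' a ha b hb b' hb' c hc c' hc' he
    exact ⟨rfl, rfl, hc⟩
  -- Q = pairs (p, q) completed inside U;  Z = the block-diagonal triples
  set Q : Finset (Σ _ : (Σ _ : Fin N, H × H), (Σ _ : Fin N, H × H)) :=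
    SS.sigma fun p => TT.filter fun q => -(f p + f q) ∈ U with hQdef
  set Z : Finset (Σ _ : Fin N, H × (H × H)) := univ.sigma fun i => A i ×ˢ (B i ×ˢ C i) with hZdef
  have hZcard : Z.card = ∑ i, (A i).card * (B i).card * (C i).card := by
    rw [hZdef, Finset.card_sigma]
    exact Finset.sum_congr rfl fun i _ => by rw [Finset.card_product, Finset.card_product, mul_assoc]
  have memQ : ∀ r : (Σ _ : (Σ _ : Fin N, H × H), (Σ _ : Fin N, H × H)), r ∈ Q ↔
      r.1 ∈ SS ∧ r.2 ∈ TT ∧ -(f r.1 + f r.2) ∈ U := by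
    rintro ⟨p, q⟩; simp [hQdef, Finset.mem_sigma, Finset.mem_filter]
  let g : (Σ _ : (Σ _ : Fin N, H × H), (Σ _ : Fin N, H × H)) → (Σ _ : Fin N, H × (H × H)) :=
    fun r => ⟨r.1.1, (r.1.2.1, r.1.2.2, r.2.2.2)⟩
  have hmaps : Set.MapsTo g (Q : Set _) (Z : Set _) := by
    rintro ⟨p, q⟩ hr
    obtain ⟨hp, hq, hU⟩ := (memQ _).1 hr
    obtain ⟨-, -, hc⟩ := key p hp q hq hU
    obtain ⟨ha, hb⟩ := (memSS _).1 hp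
    simp only [Finset.coe_sigma, hZdef, g]
    simp [ha, hb, hc]
  have hinj : Set.InjOn g (Q : Set _) := by
    rintro ⟨⟨i, a, b⟩, ⟨j, b', c⟩⟩ hr ⟨⟨i₁, a₁, b₁⟩, ⟨j₁, b₁', c₁⟩⟩ hr₁ hg
    obtain ⟨hp, hq, hU⟩ := (memQ _).1 hr
    obtain ⟨hp₁, hq₁, hU₁⟩ := (memQ _).1 hr₁
    obtain ⟨hij, hbb, -⟩ := key _ hp _ hq hU
    obtain ⟨hij₁, hbb₁, -⟩ := key _ hp₁ _ hq₁ hU₁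
    simp only [g, Sigma.mk.injEq, heq_eq_eq, Prod.mk.injEq] at hg
    obtain ⟨rfl, rfl, rfl, rfl⟩ := hg
    simp only at hij hij₁ hbb hbb₁
    subst hij; subst hij₁; subst hbb; subst hbb₁
    rfl
  have hQZ : Q.card ≤ Z.card := Finset.card_le_card_of_injOn g hmaps hinj
  -- lower bound for `Q.card`, fibre by fibre
  have hfib : ∀ p ∈ SS, (TT.card : ℤ) - ((Fintype.card H : ℤ) - (U.card : ℤ)) ≤
      ((TT.filter fun q => -(f p + f q) ∈ U).card : ℤ) := by
    intro p hp
    have hsplit := Finset.card_filter_add_card_filter_not (s := TT) (fun q => -(f p + f q) ∈ U)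
    have hbad : (TT.filter fun q => ¬ (-(f p + f q) ∈ U)).card ≤ (univ \ U).card := by
      refine Finset.card_le_card_of_injOn (fun q => -(f p + f q)) ?_ ?_
      · intro q hq
        rw [Finset.coe_filter] at hq
        simp only [Finset.coe_sdiff, Finset.coe_univ, Set.mem_sdiff, Set.mem_univ, true_and, Finset.mem_coe]
        exact hq.2
      · intro q hq q' hq' hqq
        rw [Finset.coe_filter] at hq hq'
        have : f q = f q' := by
          have h := congrArg Neg.neg hqq
          simp only [neg_neg] at h
          exact add_left_cancel h
        exact hinjT hq.1 hq'.1 this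
    have hdiff : (univ \ U).card = Fintype.card H - U.card := Finset.card_univ_sdiff U
    have hUle : U.card ≤ Fintype.card H := Finset.card_le_univ U
    zify [hUle] at hdiff
    have hsplit' : ((TT.filter fun q => -(f p + f q) ∈ U).card : ℤ) +
        ((TT.filter fun q => ¬ (-(f p + f q) ∈ U)).card : ℤ) = TT.card := by exact_mod_cast hsplit
    have hbad' : ((TT.filter fun q => ¬ (-(f p + f q) ∈ U)).card : ℤ) ≤ ((univ \ U).card : ℤ) := by
      exact_mod_cast hbad
    linarith
  have hQcard : (Q.card : ℤ) = ∑ p ∈ SS, ((TT.filter fun q => -(f p + f q) ∈ U).card : ℤ) := by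
    rw [hQdef, Finset.card_sigma]; push_cast; rfl
  have hlow : (SS.card : ℤ) * ((TT.card : ℤ) + (UU.card : ℤ) - (Fintype.card H : ℤ)) ≤ (Q.card : ℤ) := by
    rw [hQcard, ← hUcard]
    calc (SS.card : ℤ) * ((TT.card : ℤ) + (U.card : ℤ) - (Fintype.card H : ℤ))
        = ∑ p ∈ SS, ((TT.card : ℤ) - ((Fintype.card H : ℤ) - (U.card : ℤ))) := by
          rw [Finset.sum_const, nsmul_eq_mul]; ring
      _ ≤ ∑ p ∈ SS, ((TT.filter fun q => -(f p + f q) ∈ U).card : ℤ) := Finset.sum_le_sum hfib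
  have hQZ' : (Q.card : ℤ) ≤ (Z.card : ℤ) := by exact_mod_cast hQZ
  rw [← hSScard, ← hTTcard, ← hUUcard, ← hZcard]
  push_cast
  linarith

/-- **Named fact to vendor (Lang–Weil 1954, Thm 1 + the standard decomposition into geometric
components; integrality of the leading coefficient for CONSTRUCTIBLE sets).** For `f : Fin r → F[x₁..x_e]`,
`g` of total degree `≤ D` there is `C = C(D,e,r)` such that over every finite field the locally closed set
`{f = 0, g ≠ 0}` is empty or has `μ q^d + O(q^{d−1/2})` rational points with `μ` a POSITIVE INTEGER `≤ C`
(the number of top-dimensional geometrically irreducible components defined over `F`). The tree's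
`ChatzidakisVanDenDriesMacintyre1992_mainTheorem` gives this with `μ ∈ ℚ_{>0}` only. -/
def LangWeilConstructible : Prop :=
  ∀ (D e r : ℕ), ∃ C : ℝ, 0 < C ∧ ∀ (F : Type) [Field F] [Fintype F]
    (f : Fin r → MvPolynomial (Fin e) F) (g : MvPolynomial (Fin e) F),
    (∀ j, (f j).totalDegree ≤ D) → g.totalDegree ≤ D →
    (univ.filter fun x : Fin e → F =>
        (∀ j, MvPolynomial.eval x (f j) = 0) ∧ MvPolynomial.eval x g ≠ 0).card = 0 ∨
      ∃ d μ : ℕ, d ≤ e ∧ 1 ≤ μ ∧ (μ : ℝ) ≤ C ∧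
        |((univ.filter fun x : Fin e → F =>
            (∀ j, MvPolynomial.eval x (f j) = 0) ∧ MvPolynomial.eval x g ≠ 0).card : ℝ)
          - (μ : ℝ) * (Fintype.card F : ℝ) ^ d| ≤ C * (Fintype.card F : ℝ) ^ ((d : ℝ) - 1 / 2)

/-- **Exact-stratum absurdity** (the kill of card 2, pure counting over `half_density`): a balanced frame
family (`d ≥ 1`, `3d ≤ m`) whose index set has density `≥ 3/4` against the packing bound `q^{m−2d}` cannot be
STPP once `q` is large (`|S| ≥ (3/4 − o(1)) q^m` for all three colour cones forces
`∑|A||B||C| ≥ |S|(|T|+|U|−q^m) ≳ q^{2m}/3`, but `∑|A||B||C| = N (q^d−1)^3 ≤ q^{m+d}`). -/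
theorem exact_stratum_absurd (m d : ℕ) (hd : 1 ≤ d) (h3 : 3 * d ≤ m) : ∃ q₀ : ℕ, ∀ (F : Type) [Field F]
    [Fintype F] (N : ℕ) (V W U : Fin N → Submodule F (Fin m → F)) (A B C : Fin N → Finset (Fin m → F)),
    q₀ ≤ Fintype.card F →
    (∀ i v, v ∈ A i ↔ v ∈ V i ∧ v ≠ 0) → (∀ i v, v ∈ B i ↔ v ∈ W i ∧ v ≠ 0) →
    (∀ i v, v ∈ C i ↔ v ∈ U i ∧ v ≠ 0) →
    (∀ i, Module.finrank F (V i) = d ∧ Module.finrank F (W i) = d ∧ Module.finrank F (U i) = d) →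
    4 * N ≥ 3 * Fintype.card F ^ (m - 2 * d) → ¬ IsSTPP A B C := by
  sorry

/-! ## Card 3 — galois-multiplicity-osculation -/

/-- **`3d = m` rigidity, all families** (generalises the route support `RankThreeNoGo`, `d = 1`): if the three
frame dimensions are `d ≥ 1` and `3d = m` then `V i ⊕ W i ⊕ U i = F^m` for every block, the pair patterns
force the `(D,E,G)`-flats of any two blocks to be cyclic rotations of each other, and three rotations violate
the all-distinct pattern: at most two blocks (`|F| ≥ 4`). Provable now; order-zero instance of the
specialisation engine. -/
theorem threeD_le_two (F : Type*) [Field F] [Fintype F] (hq : 4 ≤ Fintype.card F) (d N : ℕ) (hd : 1 ≤ d)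
    (V W U : Fin N → Submodule F (Fin (3 * d) → F)) (A B C : Fin N → Finset (Fin (3 * d) → F))
    (hA : ∀ i v, v ∈ A i ↔ v ∈ V i ∧ v ≠ 0) (hB : ∀ i v, v ∈ B i ↔ v ∈ W i ∧ v ≠ 0)
    (hC : ∀ i v, v ∈ C i ↔ v ∈ U i ∧ v ≠ 0)
    (hdim : ∀ i, Module.finrank F (V i) = d ∧ Module.finrank F (W i) = d ∧ Module.finrank F (U i) = d)
    (hS : IsSTPP A B C) : N ≤ 2 := by
  sorry

/-- **Big-frame rigidity for ALGEBRAIC families, `m < 4d`** (first genuine output of the arithmetic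
bad-locus principle: global degeneracy of the generic pair kernel + specialisation to the diagonal): in the
crux's own typing with `dA = dB = dC = d` and `m < 4d`, the number of FULL blocks (all three ranks `= d`) of a
bounded-degree polynomial frame family that is STPP on all rational index points is bounded by a constant of
the complexity alone — no positive-dimensional algebraic STPP frame family exists in this regime. -/
theorem card_bounded_of_lt_four_mul (D e m d r : ℕ) (hmd : m < 4 * d) : ∃ Cb : ℕ,
    ∀ (F : Type) [Field F] [Fintype F] (f : Fin r → MvPolynomial (Fin e) F) (g : MvPolynomial (Fin e) F)
    (MA : Matrix (Fin m) (Fin d) (MvPolynomial (Fin e) F)) (MB : Matrix (Fin m) (Fin d) (MvPolynomial (Fin e) F))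
    (MC : Matrix (Fin m) (Fin d) (MvPolynomial (Fin e) F)),
    (∀ j, (f j).totalDegree ≤ D) → g.totalDegree ≤ D → (∀ i j, (MA i j).totalDegree ≤ D) →
    (∀ i j, (MB i j).totalDegree ≤ D) → (∀ i j, (MC i j).totalDegree ≤ D) →
    ∀ (I : Finset (Fin e → F)) (A B C : (Fin e → F) → Finset (Fin m → F)),
    (∀ x, x ∈ I ↔ (∀ j, MvPolynomial.eval x (f j) = 0) ∧ MvPolynomial.eval x g ≠ 0) →
    (∀ x v, v ∈ A x ↔ v ∈ LinearMap.range (Matrix.mulVecLin (MA.map (MvPolynomial.eval x))) ∧ v ≠ 0) →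
    (∀ x v, v ∈ B x ↔ v ∈ LinearMap.range (Matrix.mulVecLin (MB.map (MvPolynomial.eval x))) ∧ v ≠ 0) →
    (∀ x v, v ∈ C x ↔ v ∈ LinearMap.range (Matrix.mulVecLin (MC.map (MvPolynomial.eval x))) ∧ v ≠ 0) →
    (∀ (N : ℕ) (ι : Fin N → (Fin e → F)), Function.Injective ι → (∀ i, ι i ∈ I) →
      IsSTPP (fun i => A (ι i)) (fun i => B (ι i)) (fun i => C (ι i))) →
    (I.filter fun x => (A x).card + 1 = Fintype.card F ^ d ∧ (B x).card + 1 = Fintype.card F ^ d ∧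
        (C x).card + 1 = Fintype.card F ^ d).card ≤ Cb := by
  sorry

end Summit.MatrixMultiplication.MatrixMultiplication.Cruxes.AlgebraicFrameBarrier.Sketch
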